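import Summits.ResolutionOfSingularities.ResolutionOfSingularities.Theorems.EquisingularLiftEquisingularLiftNatClusterStepDischarge
import Summits.ResolutionOfSingularities.ResolutionOfSingularities.Theorems.EquisingularLiftEquisingularLiftNatClusterStepTangentDefs
import HarnessLib

/-!
# [OURS · L1 W4.5(b) · EL♮(3)] CLUSTERSTEP v3 — discharge of the TANGENT WITNESS `ClusterTangentWitness` in the automatic range
# `Σ_t m_t + 1 ≤ dg + 1` (rung v7′ TC⁺⁺, `stub_elnat_tcPlusPlusPointResolution` v2 over `ReachTCPlusPlus₂`, crux EL♮(3)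
# stmt-ResolutionOfSingularities-20148 / parent EL♮ stmt-20038)

NOT a statement of any manuscript. Helper file of the chain res-L1-w45b (cell `res-hironaka`, LADDER-RESOLUTION rung L, slot W4.5(b));
OURS; AI-written, weaker than expert review; `--supports stmt-ResolutionOfSingularities-20148 --as helper` by res-L1-w45b-stub-3 (the append
promised with CLUSTERSTEP-DELTA 09ab8846f4e69326, now that res-L1-w45b-lead-2's Defs v2 …NatClusterStepTangentDefs p536699 are in the tree).
No `sorry`; standard axioms. It closes nothing by itself.

* `sum_update_succ` — `Σ_x update m t (m t + 1) x = Σ_x m x + 1`;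
* **`clusterTangentWitness_of_sum_le`** — DISTINCT cluster points and `Σ_t m t + 1 ≤ dg + 1` ⟹ `ClusterTangentWitness dg s i a m`
  (each singly-fattened cluster has `Σ ≤ dg + 1`, so res-L1-w45b-stub-3's `clusterNonSuperabundant_of_sum_le`, p532712, applies);
* `clusterTangentWitness_of_fatCluster_of_sum_le` — the same from a `FatCluster` (its DISTINCT clause);
* `carrierCluster₂_clauses_of_sum_le` — both (b) `ClusterNonSuperabundant` and (b′) `ClusterTangentWitness` at once in that range.

References: res-L1-w45b-stub-3 …NatClusterStepDischarge (p532712), …NatClusterLiftSurj (p528441); res-L1-w45b-lead-2 …NatClusterStepTangentDefs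
(p536699); res-L1-w45b-stub-4 DESIGN NOTE 2026-08-27T13:00:53Z (the tangent-witness clause). OURS planning texts, index only.
-/

set_option linter.dupNamespace false -- mandated namespace `Summit.<Summit>.<Problem>` of this single-conjunct summit

noncomputable section

open MvPolynomial

namespace Summit.ResolutionOfSingularities.ResolutionOfSingularities.Cruxes.EquisingularLiftNat.Sections

variable {k' : Type} [Field k'] {dg s : ℕ}

/-- Fattening one point by one raises the total multiplicity by one: `Σ_x update m t (m t + 1) x = Σ_x m x + 1`. [folklore] -/
theorem sum_update_succ (m : Fin s → ℕ) (t : Fin s) :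
    ∑ x, Function.update m t (m t + 1) x = ∑ x, m x + 1 := by
  classical
  rw [Finset.sum_update_of_mem (Finset.mem_univ t), Finset.sdiff_singleton_eq_erase, ← Finset.add_sum_erase Finset.univ m
    (Finset.mem_univ t)]
  ring

/-- **The tangent witness in the automatic range**: for a cluster with pairwise DISTINCT points and `Σ_t m t + 1 ≤ dg + 1`, every
singly-fattened cluster is still non-superabundant, i.e. `ClusterTangentWitness dg s i a m` (CLUSTERSTEP v3 (b′)). [OURS · L1 W4.5b] rung v7′
TC⁺⁺ (`CarrierCluster₂`); NOT a statement of the manuscript. -/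
theorem clusterTangentWitness_of_sum_le (i : Fin s → Fin 3) (a : (t : Fin s) → {j : Fin 3 // j ≠ i t} → k') (m : Fin s → ℕ)
    (hdist : ∀ t t', t ≠ t' → ¬ ∃ r : k', (fun l : Fin 3 => if h : l = i t' then (1 : k') else a t' ⟨l, h⟩) =
      r • (fun l : Fin 3 => if h : l = i t then (1 : k') else a t ⟨l, h⟩))
    (hd : ∑ t, m t + 1 ≤ dg + 1) : ClusterTangentWitness dg s i a m :=
  fun t => clusterNonSuperabundant_of_sum_le i a (Function.update m t (m t + 1)) hdist (by rw [sum_update_succ]; exact hd)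

/-- **The DISTINCT clause of a `FatCluster` plus `Σ_t m t + 1 ≤ dg + 1` gives the tangent witness.** [OURS · L1 W4.5b] -/
theorem clusterTangentWitness_of_fatCluster_of_sum_le {g : MvPolynomial (Fin 3) k'} {i : Fin s → Fin 3}
    {a : (t : Fin s) → {j : Fin 3 // j ≠ i t} → k'} {m : Fin s → ℕ} (hF : FatCluster g s i a m)
    (hd : ∑ t, m t + 1 ≤ dg + 1) : ClusterTangentWitness dg s i a m :=
  clusterTangentWitness_of_sum_le i a m hF.2.1 hd

/-- **Both cluster clauses of `CarrierCluster₂` in the automatic range**: a `FatCluster` with `Σ_t m t + 1 ≤ dg + 1` is non-superabundant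
and has the tangent witness. [OURS · L1 W4.5b] -/
theorem carrierCluster₂_clauses_of_sum_le {g : MvPolynomial (Fin 3) k'} {i : Fin s → Fin 3}
    {a : (t : Fin s) → {j : Fin 3 // j ≠ i t} → k'} {m : Fin s → ℕ} (hF : FatCluster g s i a m)
    (hd : ∑ t, m t + 1 ≤ dg + 1) : ClusterNonSuperabundant dg s i a m ∧ ClusterTangentWitness dg s i a m :=
  ⟨clusterNonSuperabundant_of_fatCluster_of_sum_le hF (Nat.le_of_succ_le hd), clusterTangentWitness_of_fatCluster_of_sum_le hF hd⟩

end Summit.ResolutionOfSingularities.ResolutionOfSingularities.Cruxes.EquisingularLiftNat.Sections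

end
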